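import Literature.Probability.MarkovChains.BottleneckRatio
import Literature.Probability.MarkovChains.DistinguishingStatistic

/-!
HONEST FRAMING: exact (Metropolis-corrected) sampling algorithms for lattice gauge theory; figures
of merit are autocorrelation/cost numbers at stated couplings and volumes; no continuum-physics
claim.

# ApproximateEigenfunctionFloor — WILSON'S LOWER-BOUND METHOD WITH A DEFECT: A STATISTIC `Φ` WITH `|PΦ − λΦ| ≤ δ` POINTWISE AND ONE-STEP SQUARE INCREMENTS `≤ R` HAS
# `|E_xΦ(X_t) − λᵗΦ(x)| ≤ δ/(1−λ)`, `Var_xΦ(X_t), Var_πΦ ≤ (R + 2δ²/(1−λ))/(1−λ)`, `|E_πΦ| ≤ δ/(1−λ)`, HENCE `d(t) ≥ 1/2` WHILE `λᵗ|Φ(x)| ≥ 2δ/(1−λ) + 4D`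
# (`D² ≥ (R + 2δ²/(1−λ))/(1−λ)`) AND **`t_mix(1/4) ≥ (λ/(1−λ))·log(|Φ(x)|/(2δ/(1−λ) + 4D))`** (lean-2 GEN-46, ours)

Venture-side (OURS).  Cell `lqcd-flow` (pub-lqcd), unit `pub-lqcd-lean-2-g46`, 2026-08-31.  Chapter AF (the law-free `½·log K` WITH persistence), file 1 — the generic
mechanism, for an ABSTRACT row-stochastic kernel `P` on a finite `X` with a stationary probability vector `π`, a statistic `Φ : X → ℝ`, a number `0 ≤ λ < 1` and a DEFECT
`δ`: `|Σ_y P(x,y)Φ(y) − λΦ(x)| ≤ δ` for all `x` (an approximate eigenfunction), together with Wilson's increment bound `Σ_y P(x,y)[Φ(y) − Φ(x)]² ≤ R`.  Levin–Peres–Wilmer's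
Theorem 13.28 (D. B. Wilson 2004; `Literature/Probability/MarkovChains/WilsonMethod`) is the case `δ = 0`, where `E_xΦ(X_t) = λᵗΦ(x)` exactly; with a defect the mean is
followed up to `δ/(1−λ)` and — the one point that needs care — the variance recursion survives WITHOUT the eigenvalue equation: the one-step conditional mean `m_x = (PΦ)(x)` is
`λΦ(x)` up to `δ`, and the cross term of `(m_x − λm)² = (λ(Φ(x) − m) + (m_x − λΦ(x)))²` is absorbed by the pointwise split `(u+w)² ≤ (1+γ)u² + (1+1/γ)w²` at `γ = 1−λ`
(`(2−λ)λ² ≤ λ`), so `Var_{μP} ≤ λ·Var_μ + R + 2δ²/(1−λ)` for every probability vector `μ` — along the chain and, by stationarity, under `π`.  Levin–Peres–Wilmer's Proposition 7.9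
(typed: `one_sub_le_tvDist_of_lawMean_add_le`, Chebyshev under both laws) turns the mean gap `|E_xΦ(X_t) − E_πΦ| ≥ λᵗ|Φ(x)| − 2δ/(1−λ)` into a distance floor.  Hypothesis-equations only,
no definitions.

* §1 `sq_add_le_split`, `law_sq_about` (`Σ μ(Φ − a)² = Var + (mean − a)²`), `kernel_lawVariance_le`; §2 one step: **`approxEigen_lawMean_step`**
  (`|E_{μP}Φ − λE_μΦ| ≤ δ`), **`approxEigen_lawVariance_step`** (`Var_{μP}Φ ≤ λVar_μΦ + R + 2δ²/(1−λ)`); §3 along the chain: **`approxEigen_lawMean_lawAt`**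
  (`|E_xΦ(X_t) − λᵗΦ(x)| ≤ δ/(1−λ)`), **`approxEigen_lawVariance_lawAt`** (`≤ (R + 2δ²/(1−λ))/(1−λ)`); under `π`: **`approxEigen_lawMean_stationary`** (`|E_πΦ| ≤ δ/(1−λ)`),
  **`approxEigen_lawVariance_stationary`**; §4 **`approxEigen_tvDist_ge_half`** (`‖δ_xPᵗ − π‖_TV ≥ 1/2` while `λᵗ|Φ(x)| ≥ 2δ/(1−λ) + 4D`, `D > 0`, `D² ≥ (R + 2δ²/(1−λ))/(1−λ)`),
  `approxEigen_lt_mixingTime`, `lam_pow_ge_exp` (`λᵗ ≥ e^{−t(1−λ)/λ}`), **`approxEigen_mixingTime_ge`** — **`t_mix(1/4) ≥ (λ/(1−λ))·log(|Φ(x)|/(2δ/(1−λ) + 4D))`**.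

Reading (no numerics implied): a slowly-decorrelating observable need not be an exact eigenfunction to certify that the chain is not mixed — an `O((1−λ))` defect costs an additive
constant in the observable and nothing in the rate; files 2–4 build such an observable for the lumped star with persistence, where no explicit exact eigenfunction exists.
Literature grade (cell rule): KNOWN MECHANISM (Levin–Peres–Wilmer §13.5 / Wilson 2004, and Prop. 7.9 — both typed under `Literature/`), NEW TYPING of the defect form; nothing new
cited; no new bib keys.
-/

noncomputable section

open Finset
open Literature.Probability.MarkovChains

namespace Summit.Ventures.LatticeQCDFlow.Scaling

section ApproxEigen
variable {X : Type*} [Fintype X] [DecidableEq X] {P : X → X → ℝ} {Φ : X → ℝ} {lam δ R : ℝ}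

/-! ## §1 Elementary pieces -/

omit [Fintype X] [DecidableEq X] in
/-- The split of a square: `(u+w)² ≤ (1+γ)u² + (1+1/γ)w²` for `γ > 0` (the difference is `(γu − w)²/γ`). [ours] -/
theorem sq_add_le_split {γ : ℝ} (hγ : 0 < γ) (u w : ℝ) : (u + w) ^ 2 ≤ (1 + γ) * u ^ 2 + (1 + 1 / γ) * w ^ 2 := by
  have e : (1 + γ) * u ^ 2 + (1 + 1 / γ) * w ^ 2 - (u + w) ^ 2 = (γ * u - w) ^ 2 / γ := by
    field_simp
    ring
  have : 0 ≤ (γ * u - w) ^ 2 / γ := div_nonneg (sq_nonneg _) hγ.le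
  linarith

omit [DecidableEq X] in
/-- Second moment about any point: `Σ_y μ(y)(Φ(y) − a)² = Var_μΦ + (E_μΦ − a)²` for a unit-mass `μ`. [ours] -/
theorem law_sq_about {μ : X → ℝ} (hμ1 : ∑ y, μ y = 1) (Φ : X → ℝ) (a : ℝ) :
    ∑ y, μ y * (Φ y - a) ^ 2 = lawVariance μ Φ + (lawMean μ Φ - a) ^ 2 := by
  unfold lawVariance
  set m := lawMean μ Φ with hm
  have h : ∀ y, μ y * (Φ y - a) ^ 2 = μ y * (Φ y - m) ^ 2 + 2 * (m - a) * (μ y * Φ y) + ((m - a) ^ 2 - 2 * (m - a) * m) * μ y := by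
    intro y; ring
  simp_rw [h, sum_add_distrib, ← mul_sum, hμ1]
  unfold lawMean at hm
  rw [← hm]
  ring

omit [DecidableEq X] in
/-- The one-step conditional variance is at most Wilson's increment bound: `Var_{P(x,·)}Φ = Σ_y P(x,y)(Φ y − Φ x)² − ((PΦ)(x) − Φ(x))² ≤ R`. [ours] -/
theorem kernel_lawVariance_le (hP : IsRowStochastic P) (hR : ∀ x, ∑ y, P x y * (Φ y - Φ x) ^ 2 ≤ R) (x : X) : lawVariance (P x) Φ ≤ R := by
  have h := law_sq_about (hP.2 x) Φ (Φ x)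
  nlinarith [hR x, sq_nonneg (lawMean (P x) Φ - Φ x)]

/-! ## §2 One step of the two moments -/

omit [DecidableEq X] in
/-- **THE MEAN, ONE STEP:** for a probability vector `μ`, **`|E_{μP}Φ − λ·E_μΦ| ≤ δ`**. [ours] -/
theorem approxEigen_lawMean_step (hΦ : ∀ x, |∑ y, P x y * Φ y - lam * Φ x| ≤ δ) {μ : X → ℝ} (hμ0 : ∀ x, 0 ≤ μ x) (hμ1 : ∑ x, μ x = 1) :
    |lawMean (stepLaw P μ) Φ - lam * lawMean μ Φ| ≤ δ := by
  -- `E_{μP}[Φ] = E_μ[PΦ]` (chapter AD file 6's `floor_stepLaw_expect`, inlined to keep this file generic)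
  have hex : ∑ y, stepLaw P μ y * Φ y = ∑ x, μ x * ∑ y, P x y * Φ y := by
    unfold stepLaw
    simp_rw [sum_mul, mul_sum]
    rw [sum_comm]
    exact sum_congr rfl fun x _ => sum_congr rfl fun y _ => by ring
  have e : lawMean (stepLaw P μ) Φ - lam * lawMean μ Φ = ∑ x, μ x * (∑ y, P x y * Φ y - lam * Φ x) := by
    unfold lawMean
    rw [hex, mul_sum, ← sum_sub_distrib]
    exact sum_congr rfl fun x _ => by ring
  rw [e]
  calc |∑ x, μ x * (∑ y, P x y * Φ y - lam * Φ x)| ≤ ∑ x, |μ x * (∑ y, P x y * Φ y - lam * Φ x)| := abs_sum_le_sum_abs _ _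
    _ = ∑ x, μ x * |∑ y, P x y * Φ y - lam * Φ x| := sum_congr rfl fun x _ => by rw [abs_mul, abs_of_nonneg (hμ0 x)]
    _ ≤ ∑ x, μ x * δ := sum_le_sum fun x _ => mul_le_mul_of_nonneg_left (hΦ x) (hμ0 x)
    _ = δ := by rw [← sum_mul, hμ1, one_mul]

omit [DecidableEq X] in
/-- **THE VARIANCE, ONE STEP (no eigenvalue equation needed):** for a probability vector `μ`, `0 ≤ λ < 1`,
**`Var_{μP}Φ ≤ λ·Var_μΦ + R + 2δ²/(1−λ)`** — the second moment of `μP` about `λE_μΦ` is `Σ_x μ(x)[Var_{P(x,·)}Φ + (m_x − λm)²]`, `Var_{P(x,·)} ≤ R`, and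
`(m_x − λm)² ≤ (2−λ)λ²(Φ(x) − m)² + ((2−λ)/(1−λ))δ² ≤ λ(Φ(x) − m)² + 2δ²/(1−λ)` by the split at `γ = 1−λ`. [ours] -/
theorem approxEigen_lawVariance_step (hP : IsRowStochastic P) (hΦ : ∀ x, |∑ y, P x y * Φ y - lam * Φ x| ≤ δ) (hlam0 : 0 ≤ lam) (hlam1 : lam < 1)
    (hR : ∀ x, ∑ y, P x y * (Φ y - Φ x) ^ 2 ≤ R) {μ : X → ℝ} (hμ0 : ∀ x, 0 ≤ μ x) (hμ1 : ∑ x, μ x = 1) :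
    lawVariance (stepLaw P μ) Φ ≤ lam * lawVariance μ Φ + (R + 2 * δ ^ 2 / (1 - lam)) := by
  have h1l : 0 < 1 - lam := by linarith
  set m : ℝ := lawMean μ Φ with hm
  -- the second moment of `μP` about `λm`
  have hmass : ∑ y, stepLaw P μ y = 1 := by rw [sum_stepLaw hP, hμ1]
  have h1 : lawVariance (stepLaw P μ) Φ ≤ ∑ y, stepLaw P μ y * (Φ y - lam * m) ^ 2 := by
    rw [law_sq_about hmass]; nlinarith [sq_nonneg (lawMean (stepLaw P μ) Φ - lam * m)]
  have hex : ∑ y, stepLaw P μ y * (Φ y - lam * m) ^ 2 = ∑ x, μ x * ∑ y, P x y * (Φ y - lam * m) ^ 2 := by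
    unfold stepLaw
    simp_rw [sum_mul, mul_sum]
    rw [sum_comm]
    exact sum_congr rfl fun x _ => sum_congr rfl fun y _ => by ring
  rw [hex] at h1
  -- pointwise in `x`
  have h2 : ∀ x, ∑ y, P x y * (Φ y - lam * m) ^ 2 ≤ R + 2 * δ ^ 2 / (1 - lam) + lam * (Φ x - m) ^ 2 := by
    intro x
    rw [law_sq_about (hP.2 x)]
    have hv := kernel_lawVariance_le hP hR x
    have hsplit := sq_add_le_split h1l (lam * (Φ x - m)) (lawMean (P x) Φ - lam * Φ x)
    have e1 : lam * (Φ x - m) + (lawMean (P x) Φ - lam * Φ x) = lawMean (P x) Φ - lam * m := by ring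
    rw [e1] at hsplit
    have hd : (lawMean (P x) Φ - lam * Φ x) ^ 2 ≤ δ ^ 2 := by
      have := hΦ x
      unfold lawMean
      have hδ0 : 0 ≤ δ := le_trans (abs_nonneg _) this
      rw [← sq_abs]
      exact pow_le_pow_left₀ (abs_nonneg _) this 2
    have hc1 : (1 + (1 - lam)) * (lam * (Φ x - m)) ^ 2 ≤ lam * (Φ x - m) ^ 2 := by
      have : (1 + (1 - lam)) * lam ^ 2 ≤ lam := by nlinarith [sq_nonneg (1 - lam)]
      have h0 : 0 ≤ (Φ x - m) ^ 2 := sq_nonneg _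
      nlinarith
    have hc2 : (1 + 1 / (1 - lam)) * (lawMean (P x) Φ - lam * Φ x) ^ 2 ≤ 2 * δ ^ 2 / (1 - lam) := by
      have hcoef : 1 + 1 / (1 - lam) ≤ 2 / (1 - lam) := by
        have e3 : 1 + 1 / (1 - lam) = (2 - lam) / (1 - lam) := by field_simp; ring
        rw [e3]; exact div_le_div_of_nonneg_right (by linarith) h1l.le
      have hcoef0 : 0 ≤ 1 + 1 / (1 - lam) := by positivity
      calc (1 + 1 / (1 - lam)) * (lawMean (P x) Φ - lam * Φ x) ^ 2 ≤ (1 + 1 / (1 - lam)) * δ ^ 2 := mul_le_mul_of_nonneg_left hd hcoef0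
        _ ≤ 2 / (1 - lam) * δ ^ 2 := mul_le_mul_of_nonneg_right hcoef (sq_nonneg _)
        _ = 2 * δ ^ 2 / (1 - lam) := by ring
    linarith
  calc lawVariance (stepLaw P μ) Φ ≤ ∑ x, μ x * ∑ y, P x y * (Φ y - lam * m) ^ 2 := h1
    _ ≤ ∑ x, μ x * (R + 2 * δ ^ 2 / (1 - lam) + lam * (Φ x - m) ^ 2) := sum_le_sum fun x _ => mul_le_mul_of_nonneg_left (h2 x) (hμ0 x)
    _ = (R + 2 * δ ^ 2 / (1 - lam)) * ∑ x, μ x + lam * ∑ x, μ x * (Φ x - m) ^ 2 := by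
        rw [mul_sum, mul_sum, ← sum_add_distrib]; exact sum_congr rfl fun x _ => by ring
    _ = lam * lawVariance μ Φ + (R + 2 * δ ^ 2 / (1 - lam)) := by rw [hμ1, mul_one, hm]; unfold lawVariance; ring

/-! ## §3 Along the chain from a point mass, and under `π` -/

/-- `E_{δ_x}Φ = Φ(x)`. [ours] -/
theorem lawMean_single (x : X) (Φ : X → ℝ) : lawMean (Pi.single x (1 : ℝ)) Φ = Φ x := by
  unfold lawMean
  rw [Finset.sum_eq_single x (fun y _ hy => by rw [Pi.single_apply, if_neg hy, zero_mul]) (fun h => absurd (mem_univ x) h)]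
  simp

/-- `Var_{δ_x}Φ = 0`. [ours] -/
theorem lawVariance_single (x : X) (Φ : X → ℝ) : lawVariance (Pi.single x (1 : ℝ)) Φ = 0 := by
  unfold lawVariance
  rw [lawMean_single]
  rw [Finset.sum_eq_single x (fun y _ hy => by rw [Pi.single_apply, if_neg hy, zero_mul]) (fun h => absurd (mem_univ x) h)]
  simp

/-- **THE MEAN ALONG THE CHAIN:** `0 ≤ λ < 1` ⇒ **`|E_xΦ(X_t) − λᵗΦ(x)| ≤ δ/(1−λ)`** for every `t`. [ours] -/
theorem approxEigen_lawMean_lawAt (hP : IsRowStochastic P) (hΦ : ∀ x, |∑ y, P x y * Φ y - lam * Φ x| ≤ δ) (hlam0 : 0 ≤ lam) (hlam1 : lam < 1)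
    (x : X) (t : ℕ) : |lawMean (lawAt P (Pi.single x 1) t) Φ - lam ^ t * Φ x| ≤ δ / (1 - lam) := by
  have h1l : 0 < 1 - lam := by linarith
  have hδ0 : 0 ≤ δ := le_trans (abs_nonneg _) (hΦ x)
  have hμ0 : ∀ z, 0 ≤ (Pi.single x (1 : ℝ) : X → ℝ) z := fun z => by rw [Pi.single_apply]; split_ifs <;> norm_num
  induction t with
  | zero =>
      rw [lawAt_zero, lawMean_single, pow_zero, one_mul, sub_self, abs_zero]
      exact div_nonneg hδ0 h1l.le
  | succ t ih =>
      rw [lawAt_succ]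
      have hstep := approxEigen_lawMean_step hΦ (fun z => lawAt_nonneg hP hμ0 t z) (by rw [sum_lawAt hP, Finset.sum_pi_single']; simp)
      have e : lawMean (stepLaw P (lawAt P (Pi.single x 1) t)) Φ - lam ^ (t + 1) * Φ x
          = (lawMean (stepLaw P (lawAt P (Pi.single x 1) t)) Φ - lam * lawMean (lawAt P (Pi.single x 1) t) Φ)
            + lam * (lawMean (lawAt P (Pi.single x 1) t) Φ - lam ^ t * Φ x) := by ring
      rw [e]
      calc |lawMean (stepLaw P (lawAt P (Pi.single x 1) t)) Φ - lam * lawMean (lawAt P (Pi.single x 1) t) Φ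
              + lam * (lawMean (lawAt P (Pi.single x 1) t) Φ - lam ^ t * Φ x)|
          ≤ |lawMean (stepLaw P (lawAt P (Pi.single x 1) t)) Φ - lam * lawMean (lawAt P (Pi.single x 1) t) Φ|
              + |lam * (lawMean (lawAt P (Pi.single x 1) t) Φ - lam ^ t * Φ x)| := abs_add_le _ _
        _ ≤ δ + lam * (δ / (1 - lam)) := by
            rw [abs_mul, abs_of_nonneg hlam0]
            exact add_le_add hstep (mul_le_mul_of_nonneg_left ih hlam0)
        _ = δ / (1 - lam) := by field_simp; ring

/-- **THE VARIANCE ALONG THE CHAIN:** `0 ≤ λ < 1`, `0 ≤ R` ⇒ **`Var_xΦ(X_t) ≤ (R + 2δ²/(1−λ))/(1−λ)`** for every `t`. [ours] -/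
theorem approxEigen_lawVariance_lawAt (hP : IsRowStochastic P) (hΦ : ∀ x, |∑ y, P x y * Φ y - lam * Φ x| ≤ δ) (hlam0 : 0 ≤ lam) (hlam1 : lam < 1)
    (hR0 : 0 ≤ R) (hR : ∀ x, ∑ y, P x y * (Φ y - Φ x) ^ 2 ≤ R) (x : X) (t : ℕ) :
    lawVariance (lawAt P (Pi.single x 1) t) Φ ≤ (R + 2 * δ ^ 2 / (1 - lam)) / (1 - lam) := by
  have h1l : 0 < 1 - lam := by linarith
  have hB0 : 0 ≤ R + 2 * δ ^ 2 / (1 - lam) := by positivity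
  have hμ0 : ∀ z, 0 ≤ (Pi.single x (1 : ℝ) : X → ℝ) z := fun z => by rw [Pi.single_apply]; split_ifs <;> norm_num
  induction t with
  | zero => rw [lawAt_zero, lawVariance_single]; exact div_nonneg hB0 h1l.le
  | succ t ih =>
      rw [lawAt_succ]
      have hstep := approxEigen_lawVariance_step hP hΦ hlam0 hlam1 hR (fun z => lawAt_nonneg hP hμ0 t z) (by rw [sum_lawAt hP, Finset.sum_pi_single']; simp)
      calc lawVariance (stepLaw P (lawAt P (Pi.single x 1) t)) Φ ≤ lam * lawVariance (lawAt P (Pi.single x 1) t) Φ + (R + 2 * δ ^ 2 / (1 - lam)) := hstep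
        _ ≤ lam * ((R + 2 * δ ^ 2 / (1 - lam)) / (1 - lam)) + (R + 2 * δ ^ 2 / (1 - lam)) := by
            have := mul_le_mul_of_nonneg_left ih hlam0; linarith
        _ = (R + 2 * δ ^ 2 / (1 - lam)) / (1 - lam) := by field_simp; ring

omit [DecidableEq X] in
/-- **UNDER A STATIONARY PROBABILITY VECTOR:** `λ < 1` ⇒ **`|E_πΦ| ≤ δ/(1−λ)`**. [ours] -/
theorem approxEigen_lawMean_stationary (hΦ : ∀ x, |∑ y, P x y * Φ y - lam * Φ x| ≤ δ) (hlam1 : lam < 1) {π : X → ℝ} (hπ0 : ∀ x, 0 ≤ π x) (hπ1 : ∑ x, π x = 1)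
    (hst : IsStationary π P) : |lawMean π Φ| ≤ δ / (1 - lam) := by
  have h1l : 0 < 1 - lam := by linarith
  have hstep := approxEigen_lawMean_step hΦ hπ0 hπ1
  rw [stepLaw_eq_self_of_isStationary hst] at hstep
  rw [le_div_iff₀ h1l]
  have e : lawMean π Φ - lam * lawMean π Φ = lawMean π Φ * (1 - lam) := by ring
  rw [e, abs_mul, abs_of_pos h1l] at hstep
  exact hstep

omit [DecidableEq X] in
/-- **UNDER A STATIONARY PROBABILITY VECTOR:** `0 ≤ λ < 1` ⇒ **`Var_πΦ ≤ (R + 2δ²/(1−λ))/(1−λ)`**. [ours] -/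
theorem approxEigen_lawVariance_stationary (hP : IsRowStochastic P) (hΦ : ∀ x, |∑ y, P x y * Φ y - lam * Φ x| ≤ δ) (hlam0 : 0 ≤ lam) (hlam1 : lam < 1)
    (hR : ∀ x, ∑ y, P x y * (Φ y - Φ x) ^ 2 ≤ R) {π : X → ℝ} (hπ0 : ∀ x, 0 ≤ π x) (hπ1 : ∑ x, π x = 1) (hst : IsStationary π P) :
    lawVariance π Φ ≤ (R + 2 * δ ^ 2 / (1 - lam)) / (1 - lam) := by
  have h1l : 0 < 1 - lam := by linarith
  have hstep := approxEigen_lawVariance_step hP hΦ hlam0 hlam1 hR hπ0 hπ1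
  rw [stepLaw_eq_self_of_isStationary hst] at hstep
  rw [le_div_iff₀ h1l]
  nlinarith

/-! ## §4 The distance and mixing-time floors -/

/-- **THE DISTANCE FLOOR:** `0 ≤ λ < 1`, `0 ≤ R`, `π` a stationary probability vector, `D > 0` with `D² ≥ (R + 2δ²/(1−λ))/(1−λ)`; then for every `x`, `t` with
`λᵗ|Φ(x)| ≥ 2δ/(1−λ) + 4D`: **`‖δ_xPᵗ − π‖_TV ≥ 1/2`** (Levin–Peres–Wilmer Prop. 7.9 with `r = 4`: the two means differ by at least `4D` and both variances are `≤ D²`). [ours] -/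
theorem approxEigen_tvDist_ge_half (hP : IsRowStochastic P) (hΦ : ∀ x, |∑ y, P x y * Φ y - lam * Φ x| ≤ δ) (hlam0 : 0 ≤ lam) (hlam1 : lam < 1)
    (hR0 : 0 ≤ R) (hR : ∀ x, ∑ y, P x y * (Φ y - Φ x) ^ 2 ≤ R) {π : X → ℝ} (hπ0 : ∀ x, 0 ≤ π x) (hπ1 : ∑ x, π x = 1) (hst : IsStationary π P)
    {D : ℝ} (hD0 : 0 < D) (hD : (R + 2 * δ ^ 2 / (1 - lam)) / (1 - lam) ≤ D ^ 2) (x : X) (t : ℕ) (ht : 2 * δ / (1 - lam) + 4 * D ≤ lam ^ t * |Φ x|) :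
    1 / 2 ≤ tvDist (lawAt P (Pi.single x 1) t) π := by
  have h1l : 0 < 1 - lam := by linarith
  have hμ0 : ∀ z, 0 ≤ (Pi.single x (1 : ℝ) : X → ℝ) z := fun z => by rw [Pi.single_apply]; split_ifs <;> norm_num
  have hl0 : ∀ z, 0 ≤ lawAt P (Pi.single x 1) t z := fun z => lawAt_nonneg hP hμ0 t z
  have hl1 : ∑ z, lawAt P (Pi.single x (1 : ℝ)) t z = 1 := by rw [sum_lawAt hP, Finset.sum_pi_single']; simp
  have hm1 := approxEigen_lawMean_lawAt hP hΦ hlam0 hlam1 x t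
  have hm2 := approxEigen_lawMean_stationary hΦ hlam1 hπ0 hπ1 hst
  have hV1 := approxEigen_lawVariance_lawAt hP hΦ hlam0 hlam1 hR0 hR x t
  have hV2 := approxEigen_lawVariance_stationary hP hΦ hlam0 hlam1 hR hπ0 hπ1 hst
  have hV1' : lawVariance (lawAt P (Pi.single x 1) t) Φ ≤ D ^ 2 := le_trans hV1 hD
  have hV2' : lawVariance π Φ ≤ D ^ 2 := le_trans hV2 hD
  have h8 : (1 : ℝ) - 8 / 4 ^ 2 = 1 / 2 := by norm_num
  -- the mean gap `|m_t − m_π| ≥ 4D`, with the sign of `Φ(x)`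
  have hm1' := abs_le.mp hm1
  have hm2' := abs_le.mp hm2
  have e2 : 2 * δ / (1 - lam) = δ / (1 - lam) + δ / (1 - lam) := by ring
  rcases le_or_gt 0 (Φ x) with hpos | hneg
  · rw [abs_of_nonneg hpos] at ht
    have hgap : lawMean π Φ + 4 * D ≤ lawMean (lawAt P (Pi.single x 1) t) Φ := by linarith
    have := one_sub_le_tvDist_of_lawMean_add_le hπ0 hπ1 hl0 hl1 Φ (by norm_num : (0:ℝ) < 4) hD0 hV2' hV1' hgap
    rw [h8, tvDist_comm] at this
    exact this
  · rw [abs_of_neg hneg] at ht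
    have hgap : lawMean (lawAt P (Pi.single x 1) t) Φ + 4 * D ≤ lawMean π Φ := by nlinarith [pow_nonneg hlam0 t]
    have := one_sub_le_tvDist_of_lawMean_add_le hl0 hl1 hπ0 hπ1 Φ (by norm_num : (0:ℝ) < 4) hD0 hV1' hV2' hgap
    rw [h8] at this
    exact this

/-- **BEFORE THAT TIME THE CHAIN IS NOT MIXED:** under the same hypotheses (the chain `¼`-close at some time), `λᵗ|Φ(x)| ≥ 2δ/(1−λ) + 4D` ⇒ **`t < t_mix(1/4)`**. [ours] -/
theorem approxEigen_lt_mixingTime (hP : IsRowStochastic P) (hΦ : ∀ x, |∑ y, P x y * Φ y - lam * Φ x| ≤ δ) (hlam0 : 0 ≤ lam) (hlam1 : lam < 1)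
    (hR0 : 0 ≤ R) (hR : ∀ x, ∑ y, P x y * (Φ y - Φ x) ^ 2 ≤ R) {π : X → ℝ} (hπ0 : ∀ x, 0 ≤ π x) (hπ1 : ∑ x, π x = 1) (hst : IsStationary π P)
    (hmix : ∃ t₀, worstTvDist P π t₀ ≤ 1 / 4) {D : ℝ} (hD0 : 0 < D) (hD : (R + 2 * δ ^ 2 / (1 - lam)) / (1 - lam) ≤ D ^ 2) (x : X) {t : ℕ}
    (ht : 2 * δ / (1 - lam) + 4 * D ≤ lam ^ t * |Φ x|) : t < mixingTime P π (1 / 4) := by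
  have h := approxEigen_tvDist_ge_half hP hΦ hlam0 hlam1 hR0 hR hπ0 hπ1 hst hD0 hD x t ht
  have hw := tvDist_single_le_worstTvDist P π t x
  by_contra hcon
  push Not at hcon
  obtain ⟨t₀, ht₀⟩ := hmix
  have hd := worstTvDist_le_of_mixingTime_le hP hst ht₀ hcon
  linarith

omit [Fintype X] [DecidableEq X] in
/-- `λᵗ ≥ e^{−t(1−λ)/λ}` for `0 < λ` (from `log λ ≥ 1 − 1/λ`). [ours] -/
theorem lam_pow_ge_exp (hlam0 : 0 < lam) (t : ℕ) : Real.exp (-(t * (1 - lam) / lam)) ≤ lam ^ t := by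
  have hlog : -((1 - lam) / lam) ≤ Real.log lam := by
    have := Real.one_sub_inv_le_log_of_pos hlam0
    have e : 1 - lam⁻¹ = -((1 - lam) / lam) := by field_simp; ring
    linarith
  calc Real.exp (-(t * (1 - lam) / lam)) = Real.exp (t * -((1 - lam) / lam)) := by ring_nf
    _ ≤ Real.exp (t * Real.log lam) := Real.exp_le_exp.mpr (mul_le_mul_of_nonneg_left hlog (Nat.cast_nonneg t))
    _ = lam ^ t := by rw [← Real.log_pow, Real.exp_log (pow_pos hlam0 t)]

/-- **WILSON'S LOWER BOUND WITH A DEFECT, as printed:** `P` row-stochastic with stationary probability vector `π`, `|PΦ − λΦ| ≤ δ` pointwise, `0 < λ < 1`,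
`Σ_y P(x,y)(Φ y − Φ x)² ≤ R` (`R ≥ 0`), `D > 0` with `D² ≥ (R + 2δ²/(1−λ))/(1−λ)`, the chain `¼`-close at some time; then for every `x`
**`t_mix(1/4) ≥ (λ/(1−λ))·log(|Φ(x)|/(2δ/(1−λ) + 4D))`**. [ours] -/
theorem approxEigen_mixingTime_ge (hP : IsRowStochastic P) (hΦ : ∀ x, |∑ y, P x y * Φ y - lam * Φ x| ≤ δ) (hlam0 : 0 < lam) (hlam1 : lam < 1)
    (hR0 : 0 ≤ R) (hR : ∀ x, ∑ y, P x y * (Φ y - Φ x) ^ 2 ≤ R) {π : X → ℝ} (hπ0 : ∀ x, 0 ≤ π x) (hπ1 : ∑ x, π x = 1) (hst : IsStationary π P)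
    (hmix : ∃ t₀, worstTvDist P π t₀ ≤ 1 / 4) {D : ℝ} (hD0 : 0 < D) (hD : (R + 2 * δ ^ 2 / (1 - lam)) / (1 - lam) ≤ D ^ 2) (x : X) :
    lam / (1 - lam) * Real.log (|Φ x| / (2 * δ / (1 - lam) + 4 * D)) ≤ (mixingTime P π (1 / 4) : ℝ) := by
  have h1l : 0 < 1 - lam := by linarith
  have hδ0 : 0 ≤ δ := le_trans (abs_nonneg _) (hΦ x)
  set M : ℝ := 2 * δ / (1 - lam) + 4 * D with hM
  have hM0 : 0 < M := by rw [hM]; positivity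
  have hcoef : 0 ≤ lam / (1 - lam) := div_nonneg hlam0.le h1l.le
  by_cases hlog : Real.log (|Φ x| / M) ≤ 0
  · exact le_trans (mul_nonpos_of_nonneg_of_nonpos hcoef hlog) (Nat.cast_nonneg _)
  push Not at hlog
  have hΦ0 : 0 < |Φ x| := by
    by_contra h
    push Not at h
    have : |Φ x| = 0 := le_antisymm h (abs_nonneg _)
    rw [this, zero_div, Real.log_zero] at hlog
    exact lt_irrefl _ hlog
  by_contra h
  push Not at h
  set n := mixingTime P π (1 / 4) with hn
  -- `n < (λ/(1−λ))·log(|Φ x|/M)` gives `λⁿ|Φ x| ≥ M`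
  have h1 : (n : ℝ) * (1 - lam) / lam ≤ Real.log (|Φ x| / M) := by
    have := mul_le_mul_of_nonneg_left h.le (div_pos h1l hlam0).le
    have e1 : (1 - lam) / lam * (lam / (1 - lam) * Real.log (|Φ x| / M)) = Real.log (|Φ x| / M) := by field_simp
    have e2 : (1 - lam) / lam * (n : ℝ) = n * (1 - lam) / lam := by ring
    rw [e1, e2] at this
    exact this
  have h2 : M ≤ lam ^ n * |Φ x| := by
    calc M = Real.exp (-Real.log (|Φ x| / M)) * |Φ x| := by rw [Real.exp_neg, Real.exp_log (div_pos hΦ0 hM0)]; field_simp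
      _ ≤ Real.exp (-(n * (1 - lam) / lam)) * |Φ x| := mul_le_mul_of_nonneg_right (Real.exp_le_exp.mpr (neg_le_neg h1)) hΦ0.le
      _ ≤ lam ^ n * |Φ x| := mul_le_mul_of_nonneg_right (lam_pow_ge_exp hlam0 n) hΦ0.le
  have := approxEigen_lt_mixingTime hP hΦ hlam0.le hlam1 hR0 hR hπ0 hπ1 hst hmix hD0 hD x (t := n) (by rw [hM] at h2; exact h2)
  exact lt_irrefl _ this

end ApproxEigen

end Summit.Ventures.LatticeQCDFlow.Scaling

end
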